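import Mathlib
import Literature.LinearAlgebra.TensorNetworks.TensorTrainSplitProjectors

/-!
# Exactness of the TT projector-splitting integrator (Lubich–Oseledets–Vandereycken §5)

Lubich–Oseledets–Vandereycken, *Time integration of tensor trains*, SIAM J. Numer. Anal. 53
(2015) [cite: LubichOseledetsVandereycken2014, §5 Thm 5.1, Lemma 5.2] (arXiv:1407.2042, where
they are numbered Theorem 3 and Lemma 1), §5 "Exactness property of the integrator":

> «We show that the splitting integrator is exact when `A(t)` is a tensor of constant TT/MPS
> rank `r`.  This is similar to Theorem 4.1 in [Lubich–Oseledets 2014] for the matrix case, except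
> that in our case we require the rank of `A(t)` to be exactly `r` and not merely bounded by `r`.
>
> THEOREM 5.1.  Suppose `A(t) ∈ M` for `t ∈ [t_0, t_1]`.  Then, for sufficiently small
> `t_1 - t_0 > 0` the splitting integrators of orders one and two are exact when started from
> `Y_0 = A(t_0)`.  For example, `Y_d^+(t_1) = A(t_1)` for the first-order integrator.
>
> The proof of this theorem follows trivially from the following lemma.
>
> LEMMA 5.2.  Suppose `A(t) ∈ M` for `t ∈ [t_0, t_1]` with recursive SVDs
> `[A(t)]^{<i>} = Q_{≤ i}(t) S_i(t) Q_{≥ i+1}(t)ᵀ` for `i = 0, 1, …, d`.  Let `Y_0 = A(t_0)`, then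
> for sufficiently small `t_1 - t_0 > 0` the consecutive steps in the splitting integrator of
> §4.1 satisfy `Y_i^+(t_1) = P_{≥ i+1}^{(0)} A(t_1)` and `Y_i^-(t_1) = P_{≤ i}^{(1)} A(t_0)` for
> `i = 1, 2, …, d`, where `P_{≥ i+1}^{(0)} Z = Ten_i(Z^{<i>} Q_{≥ i+1}(t_0) Q_{≥ i+1}(t_0)ᵀ)`,
> `P_{≤ i}^{(1)} Z = Ten_i(Q_{≤ i}(t_1) Q_{≤ i}(t_1)ᵀ Z^{<i>})`.
>
> Before proving this lemma, we point out that the assumption of sufficiently small `t_1 - t_0`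
> is only because the matrices `Q_{≤ i-1}(t_1)ᵀ Q_{≤ i-1}(t_0)` and `Q_{≥ i}(t_1)ᵀ Q_{≥ i}(t_0)`
> need to be invertible. …
>
> Proof.  The proof proceeds by induction on `i` from left to right.  Since `Y_1^+(t_0) = A(t_0)`,
> we can include the case for `Y_1^+(t_1)` … by putting `Y_0^-(t_1) = Y_0^+(t_0)` and
> `P_{≤ 0}^{(1)} = 1`.  Now, suppose the statement to be true for `i > 1`.  Then,
> `Y_i^+(t_0) = Y_{i-1}^-(t_1) = P_{≤ i-1}^{(1)} A(t_0)`, which gives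
> `[Y_i^+(t_0)]^{<i-1>} = Q_{≤ i-1}(t_1) Q_{≤ i-1}(t_1)ᵀ Q_{≤ i-1}(t_0) S_{i-1}(t_0) Q_{≥ i}(t_0)ᵀ
>  = Q_{≤ i-1}(t_1) S_{i-1}^+ Q_{≥ i}(t_0)ᵀ`.
> Observe that `Y_i^+(t_0) ∈ M` since `S_{i-1}^+ = Q_{≤ i-1}(t_1)ᵀ Q_{≤ i-1}(t_0) S_{i-1}(t_0)` is
> of full rank for `t_1 - t_0` sufficiently small. … we see that the projector onto the tangent
> space at `Y_i^+(t_0)` equals `P_i^+ = P_{≤ i-1}^{(1)} P_{≥ i+1}^{(0)} = P_{≥ i+1}^{(0)} P_{≤ i-1}^{(1)}`.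
> The previous identities give with Theorem 4.1 that
> `Y_i^+(t_1) = Y_i^+(t_0) + P_i^+ A(t_1) - P_i^+ A(t_0)
>  = P_{≤ i-1}^{(1)} A(t_0) + P_{≥ i+1}^{(0)} P_{≤ i-1}^{(1)} A(t_1) - P_{≤ i-1}^{(1)} P_{≥ i+1}^{(0)} A(t_0)
>  = P_{≥ i+1}^{(0)} A(t_1)`, where we used `P_{≥ i+1}^{(0)} A(t_0) = A(t_0)` and
> `P_{≤ i-1}^{(1)} A(t_1) = A(t_1)`.  Continuing with `Y_i^-(t_0) = Y_i^+(t_1) = P_{≥ i+1}^{(0)} A(t_1)`,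
> we have `[Y_i^-(t_0)]^{<i>} = Q_{≤ i}(t_1) S_i(t_1) Q_{≥ i+1}(t_1)ᵀ Q_{≥ i+1}(t_0) Q_{≥ i+1}(t_0)ᵀ
>  = Q_{≤ i}(t_1) S_i^- Q_{≥ i+1}(t_0)ᵀ`.  This is again a recursive SVD with full rank
> `S_i^- = S_i(t_1) Q_{≥ i+1}(t_1)ᵀ Q_{≥ i+1}(t_0)`. … `P_i^- = P_{≤ i}^{(1)} P_{≥ i+1}^{(0)}` and
> Theorem 4.1 gives `Y_i^-(t_1) = Y_i^-(t_0) - P_i^- A(t_1) + P_i^- A(t_0)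
>  = P_{≥ i+1}^{(0)} A(t_1) - P_{≥ i+1}^{(0)} P_{≤ i}^{(1)} A(t_1) + P_{≤ i}^{(1)} P_{≥ i+1}^{(0)} A(t_0)
>  = P_{≤ i}^{(1)} A(t_0)`, where we used `P_{≤ i}^{(1)} A(t_1) = A(t_1)`. □
>
> Proof of Theorem 5.1.  For the forward sweep (that is, the first-order scheme), Lemma 5.2
> immediately gives exactness since `Y_d^+(t_1) = P_{≥ d+1}^{(0)} A(t_1) = A(t_1)` with
> `Q_{≥ d+1}(t_0) = 1`.»

## Dictionary

* Sites are `0`-based: the site `ℓ : Fin L` is LOV's node `i = ℓ + 1`, `d = L`; the bond right of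
  site `ℓ` is the `i`-th, with unfolding `Z^{<i>} = unfSucc Z ℓ` (rows: legs `0, …, ℓ`).  The
  operators `P_{≤ k}`, `P_{≥ k+1}` are `leftProj c k`, `rightProj c k` and `P_i^± = plusProj c ℓ`,
  `minusProj c ℓ` (`TensorTrainTangentProjector.lean`, `TensorTrainSplitProjectors.lean`).
* `A(t_1) = τ u` with `u` LEFT-ORTHOGONAL cores (`IsLeftOrth u`, `R 0 = 1`): then
  `X_{≤ k}(u) = Q_{≤ k}(t_1)` has orthonormal columns and `leftProj u k = P_{≤ k}^{(1)}`.
  `A(t_0) = τ a` with right interfaces `Q_a = rightQ a ℓ = X_{≥ i+1}(t_0)ᵀ` of FULL ROW RANK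
  (`IsUnit (Q_a Q_aᵀ).det`, automatic on `W*`, `isUnit_det_rightInterfaceFn_of_mem_fullRank`):
  then `gramProj Q_a = Q_{≥ i+1}(t_0) Q_{≥ i+1}(t_0)ᵀ` is the projection onto the row space and
  `rightProj a (ℓ+1) = P_{≥ i+1}^{(0)}` (no right-orthonormalisation of `a` is needed).
* THE MIXED TRAIN `mix u a ℓ M = (U_1, …, U_{i-1}, M • C_i, C_{i+1}, …, C_d)` (cores of `u` left of
  site `ℓ`, cores of `a` from site `ℓ` on, the core at site `ℓ` multiplied from the left by the
  bond matrix `M`): with `M = bondPlus u a ℓ = X_{≤ ℓ}(u)ᵀ X_{≤ ℓ}(a)` (LOV's `S_{i-1}^+`, the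
  factor `S_{i-1}(t_0)` being part of `X_{≤ i-1}(a)`) it is the recursive SVD
  `[Y_i^+(t_0)]^{<i-1>} = Q_{≤ i-1}(t_1) S_{i-1}^+ Q_{≥ i}(t_0)ᵀ` of `P_{≤ i-1}^{(1)} A(t_0)`
  (`leftProj_τ_eq_τ_mix`), its `ℓ`-th core being `K_i^<(t_0) = (I ⊗ S_{i-1}^+) Q_i^<(t_0)`; with
  `N = bondMinus u a ℓ = Q_u Q_aᵀ (Q_a Q_aᵀ)⁻¹` at the bond `i = ℓ + 1` (LOV's `S_i^-`, for
  right-orthonormal `a`) the train `mix u a (ℓ+1) N` is the recursive SVD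
  `[Y_i^-(t_0)]^{<i>} = Q_{≤ i}(t_1) S_i^- Q_{≥ i+1}(t_0)ᵀ` of `P_{≥ i+1}^{(0)} A(t_1)`
  (`rightProj_τ_eq_τ_mix`).
* "Sufficiently small `t_1 - t_0`": the hypothesis `IsUnit (Q_u Q_aᵀ).det` at the interior bonds
  (`Q_{≥ i}(t_1)ᵀ Q_{≥ i}(t_0)` invertible) is what the identities use; the companion condition
  (`Q_{≤ i-1}(t_1)ᵀ Q_{≤ i-1}(t_0)` invertible, i.e. `bondPlus` invertible) is what makes the
  mixed train a point of `W*` (`mix_mem_fullRank`: "`Y_i^+(t_0) ∈ M` since `S_{i-1}^+` is of full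
  rank"), so that `plusProj`/`minusProj` of the mixed train are the tangent-space projectors
  `P_i^±` at the iterate; the identities themselves hold without it.

## What is recorded

1. §1–§2: `gramProj (N Q) = gramProj Q` for invertible `N` (the row space of a recursive SVD does
   not see the full-rank middle factor); the mixed trains `mix`, their cores, interfaces and
   unfoldings (`unfolding_τ_mix`: the displayed recursive SVDs), left-orthonormality left of the
   active site, membership in `W*` (`mix_mem_fullRank`), and the two tensors of Lemma 5.2 as mixed
   trains (`leftProj_τ_eq_τ_mix`, `rightProj_τ_eq_τ_mix`).
2. §3, LEMMA 5.2, one induction step each: started from (the recursive SVD of)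
   `Y_i^+(t_0) = P_{≤ i-1}^{(1)} A(t_0)`, the `K`-substep of Theorem 4.1 with the split projector
   `P_i^+` of that representation lands on `P_{≥ i+1}^{(0)} A(t_1)` (`τ_mix_add_plusProj`); started
   from `Y_i^-(t_0) = P_{≥ i+1}^{(0)} A(t_1)`, the `S`-substep lands on `P_{≤ i}^{(1)} A(t_0)`
   (`τ_mix_sub_minusProj`); at the last site `P_{≥ d+1}^{(0)} = 1` (`τ_mix_add_plusProj_last`).
3. §4, THEOREM 5.1 for the first-order scheme (forward sweep): the sweep `sweepStart`/`sweepK`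
   (each substep evaluated by Theorem 4.1's closed form with the split projector of the current
   iterate's recursive SVD) satisfies `Y_i^+(t_0) = P_{≤ i-1}^{(1)} A(t_0)` (`sweepStart_eq`),
   `Y_i^+(t_1) = P_{≥ i+1}^{(0)} A(t_1)` (`sweepK_eq`) and `Y_d^+(t_1) = A(t_1)` (`sweepK_last_eq`:
   exactness).

Honest scope: published statements with citation tags only.  The substeps are the closed forms
of Theorem 4.1 (formalised in `TensorTrainSplitProjectors.lean`), applied with the projectors of
the explicit recursive SVDs above; that these operators are the tangent-space projectors `P_i^±`
at the iterates rests on `mix_mem_fullRank`, `transpose_unf₂_mix_mul_self` and the definitions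
of `plusProj`/`minusProj` — independence of the chosen TT decomposition is not re-proved here.
The differential equations, the QR-based bookkeeping of the sweep of §4.2 (which produces the
same tensors in other TT representations) and floating point are not modelled.  NOT formalised: the second-order (back-and-forth) scheme ("It is not
difficult to prove the analogous version of Lemma 5.2 for such a backward ordering"), the choice
of continuous factors `Q_{≤ i}(t)`, `Q_{≥ i}(t)` making the hypotheses hold for small `t_1 - t_0`,
and §6.  This formalisation is AI-produced.
-/

noncomputable section

open Matrix Finset Function
open scoped Kronecker

namespace Literature.LinearAlgebra.TensorNetworks

variable {σ : Type*}

/-! ## §1. Plumbing: the row-space projection ignores an invertible left factor -/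

section GramProj

variable {p n : Type*} [Fintype p] [Fintype n] [DecidableEq p]

/-- `Π_{N Q} = Π_Q` FOR INVERTIBLE `N`: the projection onto the row space of a recursive SVD
`Q_{≤ i}(t_1) S_i^- Q_{≥ i+1}(t_0)ᵀ` "with full rank `S_i^-`" is `P_{≥ i+1}^{(0)}`, whatever the
(invertible) middle factor.  [cite: LubichOseledetsVandereycken2014, §5 Lemma 5.2 (proof)] -/
theorem gramProj_mul_of_isUnit_det (N : Matrix p p ℝ) (Q : Matrix p n ℝ) (hN : IsUnit N.det) :
    gramProj (N * Q) = gramProj Q := by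
  have hNt : IsUnit Nᵀ.det := by rwa [Matrix.det_transpose]
  have hinv : (N * Q * (Qᵀ * Nᵀ))⁻¹ = Nᵀ⁻¹ * (Q * Qᵀ)⁻¹ * N⁻¹ := by
    rw [show N * Q * (Qᵀ * Nᵀ) = N * (Q * Qᵀ) * Nᵀ by simp only [Matrix.mul_assoc],
      Matrix.mul_inv_rev, Matrix.mul_inv_rev, Matrix.mul_assoc]
  rw [gramProj, gramProj, Matrix.transpose_mul, hinv]
  calc Qᵀ * Nᵀ * (Nᵀ⁻¹ * (Q * Qᵀ)⁻¹ * N⁻¹) * (N * Q)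
      = Qᵀ * (Nᵀ * Nᵀ⁻¹) * (Q * Qᵀ)⁻¹ * (N⁻¹ * N) * Q := by simp only [Matrix.mul_assoc]
    _ = Qᵀ * (Q * Qᵀ)⁻¹ * Q := by
        rw [Matrix.mul_nonsing_inv _ hNt, Matrix.nonsing_inv_mul _ hN, Matrix.mul_one,
          Matrix.mul_one]

end GramProj

namespace CoreSpace

variable {L : ℕ} {R : ℕ → ℕ} [Fintype σ] [DecidableEq σ]

/-! ## §2. The mixed trains: recursive SVDs of `P_{≤ i-1}^{(1)} A(t_0)` and `P_{≥ i+1}^{(0)} A(t_1)` -/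

/-- THE MIXED TRAIN `(U_1, …, U_{i-1}, M • C_i, C_{i+1}, …, C_d)`: the cores of `u` (of `A(t_1)`)
to the left of the site `ℓ`, the cores of `a` (of `A(t_0)`) from the site `ℓ` on, the core at the
site `ℓ` multiplied from the left by the bond matrix `M` — the recursive SVDs
`Q_{≤ i-1}(t_1) S_{i-1}^+ Q_{≥ i}(t_0)ᵀ` ("`K_i^<(t_0) = (I ⊗ S_{i-1}^+) Q_i^<(t_0)`") and
`Q_{≤ i}(t_1) S_i^- Q_{≥ i+1}(t_0)ᵀ` of the iterates in the proof of Lemma 5.2.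
[cite: LubichOseledetsVandereycken2014, §5 Lemma 5.2 (proof)] -/
def mix (u a : CoreSpace σ L R) (ℓ : Fin L) (M : Matrix (Fin (R ℓ)) (Fin (R ℓ)) ℝ) :
    CoreSpace σ L R :=
  update (fun j => if (j : ℕ) < ℓ then u j else a j) ℓ fun s => M * a ℓ s

omit [Fintype σ] [DecidableEq σ] in
/-- The core of the mixed train at the active site is `M • C_i`.
[cite: LubichOseledetsVandereycken2014, §5 Lemma 5.2 (proof)] -/
@[simp] theorem mix_apply_self (u a : CoreSpace σ L R) (ℓ : Fin L)
    (M : Matrix (Fin (R ℓ)) (Fin (R ℓ)) ℝ) : mix u a ℓ M ℓ = fun s => M * a ℓ s := by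
  rw [mix, update_self]

omit [Fintype σ] [DecidableEq σ] in
/-- The cores of the mixed train away from the active site.
[cite: LubichOseledetsVandereycken2014, §5 Lemma 5.2 (proof)] -/
theorem mix_apply_of_ne (u a : CoreSpace σ L R) (ℓ : Fin L) (M : Matrix (Fin (R ℓ)) (Fin (R ℓ)) ℝ)
    {j : Fin L} (hj : j ≠ ℓ) : mix u a ℓ M j = if (j : ℕ) < ℓ then u j else a j := by
  rw [mix, update_of_ne hj]

omit [Fintype σ] [DecidableEq σ] in
/-- Left of the active site the mixed train has the cores of `u` (`Q_{≤ i-1}(t_1)`).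
[cite: LubichOseledetsVandereycken2014, §5 Lemma 5.2 (proof)] -/
theorem mix_apply_of_lt (u a : CoreSpace σ L R) (ℓ : Fin L) (M : Matrix (Fin (R ℓ)) (Fin (R ℓ)) ℝ)
    {j : Fin L} (hj : (j : ℕ) < ℓ) : mix u a ℓ M j = u j := by
  rw [mix_apply_of_ne u a ℓ M (Fin.ne_of_val_ne (Nat.ne_of_lt hj)), if_pos hj]

omit [Fintype σ] [DecidableEq σ] in
/-- Right of the active site the mixed train has the cores of `a` (`Q_{≥ i+1}(t_0)`).
[cite: LubichOseledetsVandereycken2014, §5 Lemma 5.2 (proof)] -/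
theorem mix_apply_of_gt (u a : CoreSpace σ L R) (ℓ : Fin L) (M : Matrix (Fin (R ℓ)) (Fin (R ℓ)) ℝ)
    {j : Fin L} (hj : (ℓ : ℕ) < j) : mix u a ℓ M j = a j := by
  rw [mix_apply_of_ne u a ℓ M (Fin.ne_of_val_ne (Nat.ne_of_lt hj).symm), if_neg (not_lt.2 hj.le)]

omit [Fintype σ] [DecidableEq σ] in
/-- The `ℕ`-indexed cores of the mixed train left of the active site.
[cite: LubichOseledetsVandereycken2014, §5 Lemma 5.2 (proof)] -/
theorem coreFn_mix_of_lt (u a : CoreSpace σ L R) (ℓ : Fin L) (M : Matrix (Fin (R ℓ)) (Fin (R ℓ)) ℝ)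
    {k : ℕ} (hk : k < ℓ) : (mix u a ℓ M).coreFn k = u.coreFn k := by
  have hkL : k < L := lt_trans hk ℓ.2
  rw [coreFn_of_lt _ hkL, coreFn_of_lt _ hkL, mix_apply_of_lt u a ℓ M (j := ⟨k, hkL⟩) hk]

omit [Fintype σ] [DecidableEq σ] in
/-- The `ℕ`-indexed cores of the mixed train right of the active site.
[cite: LubichOseledetsVandereycken2014, §5 Lemma 5.2 (proof)] -/
theorem coreFn_mix_of_gt (u a : CoreSpace σ L R) (ℓ : Fin L) (M : Matrix (Fin (R ℓ)) (Fin (R ℓ)) ℝ)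
    {k : ℕ} (hk : (ℓ : ℕ) < k) : (mix u a ℓ M).coreFn k = a.coreFn k := by
  by_cases hkL : k < L
  · rw [coreFn_of_lt _ hkL, coreFn_of_lt _ hkL, mix_apply_of_gt u a ℓ M (j := ⟨k, hkL⟩) hk]
  · funext s
    simp only [coreFn, dif_neg hkL]

omit [Fintype σ] [DecidableEq σ] in
/-- `X_{≤ k}` OF THE MIXED TRAIN IS `X_{≤ k}(u) = Q_{≤ k}(t_1)` for `k ≤ ℓ`.
[cite: LubichOseledetsVandereycken2014, §5 Lemma 5.2 (proof)] -/
theorem leftInterfaceFn_mix (u a : CoreSpace σ L R) (ℓ : Fin L)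
    (M : Matrix (Fin (R ℓ)) (Fin (R ℓ)) ℝ) {k : ℕ} (hk : k ≤ ℓ) :
    leftInterfaceFn (mix u a ℓ M) k = leftInterfaceFn u k :=
  leftInterfaceFn_congr k fun _ hk' => coreFn_mix_of_lt u a ℓ M (lt_of_lt_of_le hk' hk)

omit [Fintype σ] [DecidableEq σ] in
/-- `X_{≥ k+1}ᵀ` OF THE MIXED TRAIN IS `X_{≥ k+1}(a)ᵀ = Q_{≥ k+1}(t_0)ᵀ` (up to `a`'s bond factors)
at the bonds `k > ℓ`.  [cite: LubichOseledetsVandereycken2014, §5 Lemma 5.2 (proof)] -/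
theorem rightInterfaceFn_mix (u a : CoreSpace σ L R) (ℓ : Fin L)
    (M : Matrix (Fin (R ℓ)) (Fin (R ℓ)) ℝ) (k m : ℕ) (h : k + m = L) (hk : (ℓ : ℕ) < k) :
    rightInterfaceFn (mix u a ℓ M) k m h = rightInterfaceFn a k m h :=
  rightInterfaceFn_congr k m h fun _ hk' => coreFn_mix_of_gt u a ℓ M (lt_of_lt_of_le hk hk')

omit [Fintype σ] [DecidableEq σ] in
/-- In particular `Q_i` (the right interface at the bond right of the active site) is `a`'s.
[cite: LubichOseledetsVandereycken2014, §5 Lemma 5.2 (proof)] -/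
theorem rightQ_mix (u a : CoreSpace σ L R) (ℓ : Fin L) (M : Matrix (Fin (R ℓ)) (Fin (R ℓ)) ℝ) :
    rightQ (mix u a ℓ M) ℓ = rightQ a ℓ :=
  rightInterfaceFn_mix u a ℓ M _ _ _ (Nat.lt_succ_self _)

omit [Fintype σ] [DecidableEq σ] in
/-- The first unfolding of the active core: `(M • C_i)^{<1>} = M C_i^{<1>}`.
[cite: LubichOseledetsVandereycken2014, §5 Lemma 5.2 (proof)] -/
theorem unf₁_mix (u a : CoreSpace σ L R) (ℓ : Fin L) (M : Matrix (Fin (R ℓ)) (Fin (R ℓ)) ℝ) :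
    (mix u a ℓ M).unf₁ ℓ = M * a.unf₁ ℓ := by
  ext α q
  simp only [unf₁, Matrix.of_apply, mix_apply_self, Matrix.mul_apply]

/-- The second unfolding of the active core: `(M • C_i)^{<2>} = (M ⊗ I) C_i^{<2>}` — LOV's
`K_i^<(t_0) = (I_{n_i} ⊗ S_{i-1}^+) Q_i^<(t_0)` (column-major Kronecker convention there).
[cite: LubichOseledetsVandereycken2014, §5 Lemma 5.2 (proof)] -/
theorem unf₂_mix (u a : CoreSpace σ L R) (ℓ : Fin L)
    (M : Matrix (Fin (R ℓ)) (Fin (R ℓ)) ℝ) :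
    (mix u a ℓ M).unf₂ ℓ = M ⊗ₖ (1 : Matrix σ σ ℝ) * a.unf₂ ℓ := by
  ext p β
  obtain ⟨α, s⟩ := p
  simp only [unf₂, Matrix.of_apply, mix_apply_self, Matrix.mul_apply, Matrix.kroneckerMap_apply,
    Fintype.sum_prod_type, Matrix.one_apply, mul_ite, mul_one, mul_zero, ite_mul, zero_mul,
    Finset.sum_ite_eq, Finset.mem_univ, if_true]

/-- THE RIGHT INTERFACE OF THE MIXED TRAIN AT ITS ACTIVE BOND is `M X_{≥ i}(a)ᵀ`: the factor
`S^± Q_{≥}(t_0)ᵀ` of the recursive SVD.  [cite: LubichOseledetsVandereycken2014, §5 Lemma 5.2 (proof)] -/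
theorem rightInterfaceFn_mix_self (u a : CoreSpace σ L R) (ℓ : Fin L)
    (M : Matrix (Fin (R ℓ)) (Fin (R ℓ)) ℝ) (m : ℕ) (h : (ℓ : ℕ) + m = L) :
    rightInterfaceFn (mix u a ℓ M) ℓ m h = M * rightInterfaceFn a ℓ m h := by
  obtain ⟨m, rfl⟩ : ∃ m', m = m' + 1 := ⟨m - 1, by have := ℓ.2; omega⟩
  rw [rightInterfaceFn_succ _ ℓ m (by omega) h, rightInterfaceFn_succ a ℓ m (by omega) h, unf₁_mix,
    rightInterfaceFn_mix u a ℓ M (ℓ + 1) m _ (Nat.lt_succ_self _), Matrix.mul_assoc]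

/-- THE UNFOLDING OF THE MIXED TRAIN AT ITS ACTIVE BOND: `X_{≤ ℓ}(u) M X_{≥ ℓ+1}(a)ᵀ` — the
recursive SVDs `[Y_i^+(t_0)]^{<i-1>} = Q_{≤ i-1}(t_1) S_{i-1}^+ Q_{≥ i}(t_0)ᵀ` and
`[Y_i^-(t_0)]^{<i>} = Q_{≤ i}(t_1) S_i^- Q_{≥ i+1}(t_0)ᵀ`.
[cite: LubichOseledetsVandereycken2014, §5 Lemma 5.2 (proof)] -/
theorem unfolding_τ_mix (u a : CoreSpace σ L R) (ℓ : Fin L) (M : Matrix (Fin (R ℓ)) (Fin (R ℓ)) ℝ)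
    (m : ℕ) (h : (ℓ : ℕ) + m = L) :
    unfolding (τ (mix u a ℓ M)) ℓ m h = leftInterfaceFn u ℓ * M * rightInterfaceFn a ℓ m h := by
  rw [unfolding_τ, leftInterfaceFn_mix u a ℓ M le_rfl, rightInterfaceFn_mix_self, Matrix.mul_assoc]

omit [DecidableEq σ] in
/-- LEFT OF THE ACTIVE SITE THE MIXED TRAIN IS LEFT-ORTHOGONAL (`Q_{≤ i-1}(t_1)ᵀ Q_{≤ i-1}(t_1) = I`:
its left part is a recursive SVD).  [cite: LubichOseledetsVandereycken2014, §5 Lemma 5.2 (proof)] -/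
theorem transpose_unf₂_mix_mul_self {u : CoreSpace σ L R} (hu : IsLeftOrth u) (a : CoreSpace σ L R)
    (ℓ : Fin L) (M : Matrix (Fin (R ℓ)) (Fin (R ℓ)) ℝ) {j : Fin L} (hj : (j : ℕ) < ℓ) :
    ((mix u a ℓ M).unf₂ j)ᵀ * (mix u a ℓ M).unf₂ j = 1 := by
  have e : (mix u a ℓ M).unf₂ j = u.unf₂ j := by
    ext q β
    simp only [unf₂, Matrix.of_apply, mix_apply_of_lt u a ℓ M hj]
  rw [e]
  exact hu j (by have := ℓ.2; omega)

/-- "OBSERVE THAT `Y_i^+(t_0) ∈ M` SINCE `S_{i-1}^+` IS OF FULL RANK": with an invertible bond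
matrix the mixed train of two points of `W*` is a point of `W*` (a TT decomposition with full-rank
unfoldings, hence of a tensor of TT-rank exactly `r`).
[cite: LubichOseledetsVandereycken2014, §5 Lemma 5.2 (proof)] -/
theorem mix_mem_fullRank {u a : CoreSpace σ L R} (hu : u ∈ fullRank σ L R) (ha : a ∈ fullRank σ L R)
    (ℓ : Fin L) {M : Matrix (Fin (R ℓ)) (Fin (R ℓ)) ℝ} (hM : IsUnit M.det) :
    mix u a ℓ M ∈ fullRank σ L R := by
  intro j
  rcases lt_trichotomy (j : ℕ) ℓ with hj | hj | hj
  · have e₁ : (mix u a ℓ M).unf₁ j = u.unf₁ j := by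
      ext α q; simp only [unf₁, Matrix.of_apply, mix_apply_of_lt u a ℓ M hj]
    have e₂ : (mix u a ℓ M).unf₂ j = u.unf₂ j := by
      ext q β; simp only [unf₂, Matrix.of_apply, mix_apply_of_lt u a ℓ M hj]
    rw [e₁, e₂]
    exact hu j
  · obtain rfl : j = ℓ := Fin.ext hj
    have hK : IsUnit (M ⊗ₖ (1 : Matrix σ σ ℝ)).det := by
      rw [Matrix.det_kronecker, Matrix.det_one, one_pow, mul_one]
      exact hM.pow _
    rw [unf₁_mix, unf₂_mix, Matrix.rank_mul_eq_right_of_isUnit_det _ _ hM,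
      Matrix.rank_mul_eq_right_of_isUnit_det _ _ hK]
    exact ha j
  · have e₁ : (mix u a ℓ M).unf₁ j = a.unf₁ j := by
      ext α q; simp only [unf₁, Matrix.of_apply, mix_apply_of_gt u a ℓ M hj]
    have e₂ : (mix u a ℓ M).unf₂ j = a.unf₂ j := by
      ext q β; simp only [unf₂, Matrix.of_apply, mix_apply_of_gt u a ℓ M hj]
    rw [e₁, e₂]
    exact ha j

/-- THE BOND MATRIX `S_{i-1}^+`-TYPE: `M_ℓ = X_{≤ ℓ}(u)ᵀ X_{≤ ℓ}(a)` — LOV's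
`S_{i-1}^+ = Q_{≤ i-1}(t_1)ᵀ Q_{≤ i-1}(t_0) S_{i-1}(t_0)`, the factor `S_{i-1}(t_0)` being part of
`X_{≤ i-1}(a)` here.  [cite: LubichOseledetsVandereycken2014, §5 Lemma 5.2 (proof)] -/
def bondPlus (u a : CoreSpace σ L R) (k : ℕ) : Matrix (Fin (R k)) (Fin (R k)) ℝ :=
  (leftInterfaceFn u k)ᵀ * leftInterfaceFn a k

/-- THE BOND MATRIX `S_i^-`-TYPE at the bond `i = ℓ + 1`: `N_ℓ = Q_u Q_aᵀ (Q_a Q_aᵀ)⁻¹` with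
`Q_u = X_{≥ i+1}(u)ᵀ`, `Q_a = X_{≥ i+1}(a)ᵀ` — LOV's `S_i^- = S_i(t_1) Q_{≥ i+1}(t_1)ᵀ Q_{≥ i+1}(t_0)`
(for a right-orthonormal `a`, `Q_a Q_aᵀ = I`).  [cite: LubichOseledetsVandereycken2014, §5 Lemma 5.2 (proof)] -/
def bondMinus (u a : CoreSpace σ L R) (ℓ : Fin L) : Matrix (Fin (R (ℓ + 1))) (Fin (R (ℓ + 1))) ℝ :=
  rightQ u ℓ * (rightQ a ℓ)ᵀ * (rightQ a ℓ * (rightQ a ℓ)ᵀ)⁻¹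

omit [DecidableEq σ] in
/-- `N_ℓ Q_a = Q_u Π_{Q_a}`: `S_i^- Q_{≥ i+1}(t_0)ᵀ = S_i(t_1) Q_{≥ i+1}(t_1)ᵀ P_{≥ i+1}^{(0)}`.
[cite: LubichOseledetsVandereycken2014, §5 Lemma 5.2 (proof)] -/
theorem bondMinus_mul_rightQ (u a : CoreSpace σ L R) (ℓ : Fin L) :
    bondMinus u a ℓ * rightQ a ℓ = rightQ u ℓ * gramProj (rightQ a ℓ) := by
  simp only [bondMinus, gramProj, Matrix.mul_assoc]

omit [DecidableEq σ] in
/-- `S_i^-` IS OF FULL RANK when `Q_{≥ i+1}(t_1)ᵀ Q_{≥ i+1}(t_0)` is invertible (and `A(t_0) ∈ M`).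
[cite: LubichOseledetsVandereycken2014, §5 Lemma 5.2 (proof)] -/
theorem isUnit_det_bondMinus (u a : CoreSpace σ L R) (ℓ : Fin L)
    (ha : IsUnit (rightQ a ℓ * (rightQ a ℓ)ᵀ).det) (hS : IsUnit (rightQ u ℓ * (rightQ a ℓ)ᵀ).det) :
    IsUnit (bondMinus u a ℓ).det := by
  rw [bondMinus, Matrix.det_mul]
  exact hS.mul (Matrix.isUnit_nonsing_inv_det _ ha)

/-- `P_{≤ k}^{(1)} A(t_0)` IS THE MIXED TRAIN WITH BOND MATRIX `S^+`:
`Ten_k(Q_{≤ k}(t_1) Q_{≤ k}(t_1)ᵀ [A(t_0)]^{<k>}) = τ(U_1, …, U_k, S_k^+ • C_{k+1}, C_{k+2}, …, C_d)`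
("`Y_i^+(t_0) = Y_{i-1}^-(t_1) = P_{≤ i-1}^{(1)} A(t_0)`, which gives
`[Y_i^+(t_0)]^{<i-1>} = Q_{≤ i-1}(t_1) S_{i-1}^+ Q_{≥ i}(t_0)ᵀ`").
[cite: LubichOseledetsVandereycken2014, §5 Lemma 5.2 (proof)] -/
theorem leftProj_τ_eq_τ_mix (u a : CoreSpace σ L R) (ℓ : Fin L) (m : ℕ) (h : (ℓ : ℕ) + m = L) :
    leftProj u ℓ m h (τ a) = τ (mix u a ℓ (bondPlus u a ℓ)) := by
  apply eq_of_unfolding_eq ℓ m h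
  rw [leftProj, unfolding_tenMulLeft, unfolding_τ, unfolding_τ_mix, bondPlus]
  simp only [Matrix.mul_assoc]

/-- `P_{≥ i+1}^{(0)} A(t_1)` IS THE MIXED TRAIN WITH BOND MATRIX `S^-` (`i = ℓ + 1 < d`):
`Ten_i([A(t_1)]^{<i>} P_{≥ i+1}^{(0)}) = τ(U_1, …, U_i, S_i^- • C_{i+1}, C_{i+2}, …, C_d)`
("`[Y_i^-(t_0)]^{<i>} = Q_{≤ i}(t_1) S_i(t_1) Q_{≥ i+1}(t_1)ᵀ Q_{≥ i+1}(t_0) Q_{≥ i+1}(t_0)ᵀ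
 = Q_{≤ i}(t_1) S_i^- Q_{≥ i+1}(t_0)ᵀ`").  [cite: LubichOseledetsVandereycken2014, §5 Lemma 5.2 (proof)] -/
theorem rightProj_τ_eq_τ_mix (u a : CoreSpace σ L R) (ℓ : Fin L) (hℓ : (ℓ : ℕ) + 1 < L) :
    rightProj a (ℓ + 1) (L - (ℓ + 1)) (succ_add_sub_succ ℓ) (τ u) =
      τ (mix u a ⟨ℓ + 1, hℓ⟩ (bondMinus u a ℓ)) := by
  apply eq_of_unfolding_eq (ℓ + 1) (L - (ℓ + 1)) (succ_add_sub_succ ℓ)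
  rw [rightProj, unfolding_tenMulRight, unfolding_τ,
    unfolding_τ_mix u a ⟨ℓ + 1, hℓ⟩ (bondMinus u a ℓ) (L - (ℓ + 1)) (succ_add_sub_succ ℓ)]
  show leftInterfaceFn u (ℓ + 1) * rightQ u ℓ * gramProj (rightQ a ℓ) =
    leftInterfaceFn u (ℓ + 1) * bondMinus u a ℓ * rightQ a ℓ
  rw [Matrix.mul_assoc, ← bondMinus_mul_rightQ, Matrix.mul_assoc]

/-! ## §3. Lemma 5.2: the two substeps map one recursive SVD to the next -/

/-- LEMMA 5.2, THE `K`-SUBSTEP: started from `Y_i^+(t_0) = P_{≤ i-1}^{(1)} A(t_0)` (in its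
recursive SVD `Q_{≤ i-1}(t_1) S_{i-1}^+ Q_{≥ i}(t_0)ᵀ`), the substep `Y_i^+(t_1) = Y_i^+(t_0) +
P_i^+ ΔA` of Theorem 4.1 (with `P_i^+ = P_{≤ i-1}^{(1)} P_{≥ i+1}^{(0)}` the split projector of that
decomposition) gives `Y_i^+(t_1) = P_{≥ i+1}^{(0)} A(t_1)`.  Hypotheses: `A(t_1) = τ u` with `u`
left-orthogonal, `A(t_0) = τ a` with `Q_{≥ i+1}(t_0)` of full rank; NO smallness is needed here.
[cite: LubichOseledetsVandereycken2014, §5 Lemma 5.2] -/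
theorem τ_mix_add_plusProj {u : CoreSpace σ L R} (hu : IsLeftOrth u) (h0 : R 0 = 1)
    (a : CoreSpace σ L R) (ℓ : Fin L) (ha : IsUnit (rightQ a ℓ * (rightQ a ℓ)ᵀ).det) :
    τ (mix u a ℓ (bondPlus u a ℓ)) + plusProj (mix u a ℓ (bondPlus u a ℓ)) ℓ (τ u - τ a) =
      rightProj a (ℓ + 1) (L - (ℓ + 1)) (succ_add_sub_succ ℓ) (τ u) := by
  set e := mix u a ℓ (bondPlus u a ℓ) with he
  have hX : (leftInterfaceFn u ℓ)ᵀ * leftInterfaceFn u ℓ = 1 :=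
    hu.transpose_leftInterface_mul_self h0 ℓ.2
  have hXe : leftInterfaceFn e ℓ = leftInterfaceFn u ℓ := leftInterfaceFn_mix u a ℓ _ le_rfl
  have hQe : rightQ e ℓ = rightQ a ℓ := rightQ_mix u a ℓ _
  have hQa : rightInterfaceFn a ℓ (L - (ℓ + 1) + 1) (add_sub_succ_succ ℓ) *
      sqKron (gramProj (rightQ a ℓ)) = rightInterfaceFn a ℓ (L - (ℓ + 1) + 1) (add_sub_succ_succ ℓ) :=
    rightInterfaceFn_mul_sqKron_gramProj a ℓ (L - (ℓ + 1)) (succ_add_sub_succ ℓ)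
      (add_sub_succ_succ ℓ) ha
  apply eq_of_unfolding_eq ℓ (L - (ℓ + 1) + 1) (add_sub_succ_succ ℓ)
  rw [unfolding_add, unfolding_plusProj, hXe, hQe, unfolding_sub, he, unfolding_τ_mix,
    unfolding_τ u, unfolding_τ a,
    rightProj_succ_eq_tenMulRight a ℓ (L - (ℓ + 1)) (succ_add_sub_succ ℓ) (add_sub_succ_succ ℓ),
    unfolding_tenMulRight, unfolding_τ u, ← rightQ_eq, Matrix.mul_sub, Matrix.sub_mul]
  have h1 : leftInterfaceFn u ℓ * (leftInterfaceFn u ℓ)ᵀ *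
      (leftInterfaceFn u ℓ * rightInterfaceFn u ℓ (L - (ℓ + 1) + 1) (add_sub_succ_succ ℓ)) *
        sqKron (gramProj (rightQ a ℓ)) =
      leftInterfaceFn u ℓ * rightInterfaceFn u ℓ (L - (ℓ + 1) + 1) (add_sub_succ_succ ℓ) *
        sqKron (gramProj (rightQ a ℓ)) := by
    rw [← Matrix.mul_assoc (leftInterfaceFn u ℓ * (leftInterfaceFn u ℓ)ᵀ),
      Matrix.mul_assoc (leftInterfaceFn u ℓ), hX, Matrix.mul_one]
  have h2 : leftInterfaceFn u ℓ * (leftInterfaceFn u ℓ)ᵀ *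
      (leftInterfaceFn a ℓ * rightInterfaceFn a ℓ (L - (ℓ + 1) + 1) (add_sub_succ_succ ℓ)) *
        sqKron (gramProj (rightQ a ℓ)) =
      leftInterfaceFn u ℓ * bondPlus u a ℓ *
        rightInterfaceFn a ℓ (L - (ℓ + 1) + 1) (add_sub_succ_succ ℓ) := by
    calc _ = leftInterfaceFn u ℓ * ((leftInterfaceFn u ℓ)ᵀ * leftInterfaceFn a ℓ) *
          (rightInterfaceFn a ℓ (L - (ℓ + 1) + 1) (add_sub_succ_succ ℓ) *
            sqKron (gramProj (rightQ a ℓ))) := by simp only [Matrix.mul_assoc]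
      _ = _ := by rw [hQa, bondPlus]
  rw [h1, h2]
  abel

/-- LEMMA 5.2, THE `K`-SUBSTEP LANDS ON THE NEXT RECURSIVE SVD (`i < d`): `Y_i^+(t_1) =
P_{≥ i+1}^{(0)} A(t_1) = τ(U_1, …, U_i, S_i^- • C_{i+1}, …)` — the starting value `Y_i^-(t_0)` of
the `S`-substep.  [cite: LubichOseledetsVandereycken2014, §5 Lemma 5.2] -/
theorem τ_mix_add_plusProj_of_lt {u : CoreSpace σ L R} (hu : IsLeftOrth u) (h0 : R 0 = 1)
    (a : CoreSpace σ L R) (ℓ : Fin L) (hℓ : (ℓ : ℕ) + 1 < L)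
    (ha : IsUnit (rightQ a ℓ * (rightQ a ℓ)ᵀ).det) :
    τ (mix u a ℓ (bondPlus u a ℓ)) + plusProj (mix u a ℓ (bondPlus u a ℓ)) ℓ (τ u - τ a) =
      τ (mix u a ⟨ℓ + 1, hℓ⟩ (bondMinus u a ℓ)) := by
  rw [τ_mix_add_plusProj hu h0 a ℓ ha, rightProj_τ_eq_τ_mix u a ℓ hℓ]

/-- LEMMA 5.2 AT THE LAST SITE / THEOREM 5.1: `Y_d^+(t_1) = P_{≥ d+1}^{(0)} A(t_1) = A(t_1)` with
`Q_{≥ d+1}(t_0) = 1` (`r_d = 1`).  [cite: LubichOseledetsVandereycken2014, §5 Thm 5.1, Lemma 5.2] -/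
theorem τ_mix_add_plusProj_last {u : CoreSpace σ L R} (hu : IsLeftOrth u) (h0 : R 0 = 1)
    (hL : R L = 1) (a : CoreSpace σ L R) (ℓ : Fin L) (hℓ : (ℓ : ℕ) + 1 = L)
    (ha : IsUnit (rightQ a ℓ * (rightQ a ℓ)ᵀ).det) :
    τ (mix u a ℓ (bondPlus u a ℓ)) + plusProj (mix u a ℓ (bondPlus u a ℓ)) ℓ (τ u - τ a) = τ u := by
  have hR : R ((ℓ : ℕ) + 1) = 1 := by rw [hℓ]; exact hL
  rw [τ_mix_add_plusProj hu h0 a ℓ ha, rightProj_eq_id a (ℓ + 1) (L - (ℓ + 1)) (succ_add_sub_succ ℓ)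
    (by omega) hR, LinearMap.id_apply]

/-- LEMMA 5.2, THE `S`-SUBSTEP: started from `Y_i^-(t_0) = P_{≥ i+1}^{(0)} A(t_1)` (in its recursive
SVD `Q_{≤ i}(t_1) S_i^- Q_{≥ i+1}(t_0)ᵀ`, `i < d`), the substep `Y_i^-(t_1) = Y_i^-(t_0) - P_i^- ΔA`
of Theorem 4.1 (with `P_i^- = P_{≤ i}^{(1)} P_{≥ i+1}^{(0)}` the split projector of that
decomposition) gives `Y_i^-(t_1) = P_{≤ i}^{(1)} A(t_0)`.  Hypotheses: `u` left-orthogonal,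
`Q_{≥ i+1}(t_0)` of full rank, and the smallness condition "`Q_{≥ i+1}(t_1)ᵀ Q_{≥ i+1}(t_0)`
invertible" (`S_i^-` of full rank).  [cite: LubichOseledetsVandereycken2014, §5 Lemma 5.2] -/
theorem τ_mix_sub_minusProj {u : CoreSpace σ L R} (hu : IsLeftOrth u) (h0 : R 0 = 1)
    (a : CoreSpace σ L R) (ℓ : Fin L) (hℓ : (ℓ : ℕ) + 1 < L)
    (ha : IsUnit (rightQ a ℓ * (rightQ a ℓ)ᵀ).det) (hS : IsUnit (rightQ u ℓ * (rightQ a ℓ)ᵀ).det) :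
    τ (mix u a ⟨ℓ + 1, hℓ⟩ (bondMinus u a ℓ)) -
        minusProj (mix u a ⟨ℓ + 1, hℓ⟩ (bondMinus u a ℓ)) ℓ (τ u - τ a) =
      leftProj u (ℓ + 1) (L - (ℓ + 1)) (succ_add_sub_succ ℓ) (τ a) := by
  set f := mix u a ⟨ℓ + 1, hℓ⟩ (bondMinus u a ℓ) with hf
  have hX : (leftInterfaceFn u (ℓ + 1))ᵀ * leftInterfaceFn u (ℓ + 1) = 1 :=
    hu.transpose_leftInterface_mul_self h0 hℓ
  have hXf : leftInterfaceFn f (ℓ + 1) = leftInterfaceFn u (ℓ + 1) :=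
    leftInterfaceFn_mix u a ⟨ℓ + 1, hℓ⟩ _ le_rfl
  have hQf : rightQ f ℓ = bondMinus u a ℓ * rightQ a ℓ :=
    rightInterfaceFn_mix_self u a ⟨ℓ + 1, hℓ⟩ _ (L - (ℓ + 1)) (succ_add_sub_succ ℓ)
  have hN : IsUnit (bondMinus u a ℓ).det := isUnit_det_bondMinus u a ℓ ha hS
  have hm := unfSucc_minusProj f ℓ (τ u - τ a)
  rw [unfSucc_eq, unfSucc_eq, hXf, hQf, gramProj_mul_of_isUnit_det _ _ hN] at hm
  apply eq_of_unfolding_eq (ℓ + 1) (L - (ℓ + 1)) (succ_add_sub_succ ℓ)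
  rw [unfolding_sub, hm, unfolding_sub, hf,
    unfolding_τ_mix u a ⟨ℓ + 1, hℓ⟩ (bondMinus u a ℓ) (L - (ℓ + 1)) (succ_add_sub_succ ℓ),
    unfolding_τ u, unfolding_τ a, leftProj, unfolding_tenMulLeft, unfolding_τ a, ← rightQ_eq,
    ← rightQ_eq]
  show leftInterfaceFn u (ℓ + 1) * bondMinus u a ℓ * rightQ a ℓ -
      leftInterfaceFn u (ℓ + 1) * (leftInterfaceFn u (ℓ + 1))ᵀ *
        (leftInterfaceFn u (ℓ + 1) * rightQ u ℓ - leftInterfaceFn a (ℓ + 1) * rightQ a ℓ) *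
          gramProj (rightQ a ℓ) =
    leftInterfaceFn u (ℓ + 1) * (leftInterfaceFn u (ℓ + 1))ᵀ * (leftInterfaceFn a (ℓ + 1) * rightQ a ℓ)
  have h1 : leftInterfaceFn u (ℓ + 1) * (leftInterfaceFn u (ℓ + 1))ᵀ *
      (leftInterfaceFn u (ℓ + 1) * rightQ u ℓ) * gramProj (rightQ a ℓ) =
      leftInterfaceFn u (ℓ + 1) * bondMinus u a ℓ * rightQ a ℓ := by
    rw [← Matrix.mul_assoc (leftInterfaceFn u (ℓ + 1) * (leftInterfaceFn u (ℓ + 1))ᵀ),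
      Matrix.mul_assoc (leftInterfaceFn u (ℓ + 1)), hX, Matrix.mul_one, Matrix.mul_assoc,
      ← bondMinus_mul_rightQ, Matrix.mul_assoc]
  have h2 : leftInterfaceFn u (ℓ + 1) * (leftInterfaceFn u (ℓ + 1))ᵀ *
      (leftInterfaceFn a (ℓ + 1) * rightQ a ℓ) * gramProj (rightQ a ℓ) =
      leftInterfaceFn u (ℓ + 1) * (leftInterfaceFn u (ℓ + 1))ᵀ *
        (leftInterfaceFn a (ℓ + 1) * rightQ a ℓ) := by
    rw [Matrix.mul_assoc (leftInterfaceFn u (ℓ + 1) * (leftInterfaceFn u (ℓ + 1))ᵀ),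
      Matrix.mul_assoc (leftInterfaceFn a (ℓ + 1)), mul_gramProj _ ha]
  rw [Matrix.mul_sub, Matrix.sub_mul, h1, h2, sub_sub_cancel]

/-- LEMMA 5.2, THE `S`-SUBSTEP LANDS ON THE NEXT RECURSIVE SVD: `Y_i^-(t_1) = P_{≤ i}^{(1)} A(t_0)
= τ(U_1, …, U_i, S_i^+ • C_{i+1}, …)` — the starting value `Y_{i+1}^+(t_0)` of the next `K`-substep.
[cite: LubichOseledetsVandereycken2014, §5 Lemma 5.2] -/
theorem τ_mix_sub_minusProj_eq_τ_mix {u : CoreSpace σ L R} (hu : IsLeftOrth u) (h0 : R 0 = 1)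
    (a : CoreSpace σ L R) (ℓ : Fin L) (hℓ : (ℓ : ℕ) + 1 < L)
    (ha : IsUnit (rightQ a ℓ * (rightQ a ℓ)ᵀ).det) (hS : IsUnit (rightQ u ℓ * (rightQ a ℓ)ᵀ).det) :
    τ (mix u a ⟨ℓ + 1, hℓ⟩ (bondMinus u a ℓ)) -
        minusProj (mix u a ⟨ℓ + 1, hℓ⟩ (bondMinus u a ℓ)) ℓ (τ u - τ a) =
      τ (mix u a ⟨ℓ + 1, hℓ⟩ (bondPlus u a (ℓ + 1))) := by
  rw [τ_mix_sub_minusProj hu h0 a ℓ hℓ ha hS]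
  exact leftProj_τ_eq_τ_mix u a ⟨ℓ + 1, hℓ⟩ (L - (ℓ + 1)) (succ_add_sub_succ ℓ)

/-- THE BASE OF THE INDUCTION: `Y_1^+(t_0) = A(t_0)` is the mixed train at the first site
(`P_{≤ 0}^{(1)} = 1`, `S_0^+ = 1`).  [cite: LubichOseledetsVandereycken2014, §5 Lemma 5.2 (proof)] -/
theorem τ_mix_zero (u a : CoreSpace σ L R) (h0 : R 0 = 1) (hL : 0 < L) :
    τ (mix u a ⟨0, hL⟩ (bondPlus u a 0)) = τ a := by
  rw [← leftProj_τ_eq_τ_mix u a ⟨0, hL⟩ L (Nat.zero_add L), leftProj_zero u h0, LinearMap.id_apply]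

/-! ## §4. Theorem 5.1: the forward sweep started at `A(t_0)` ends at `A(t_1)` -/

/-- THE FORWARD SWEEP OF THE FIRST-ORDER SPLITTING INTEGRATOR, the value `Y_{n+1}^+(t_0)` before
the `K`-substep at the (0-based) site `n`: `Y_1^+(t_0) = A(t_0)` and
`Y_{i+1}^+(t_0) = Y_i^-(t_1) = (Y_i^+(t_0) + P_i^+ ΔA) - P_i^- ΔA` (`ΔA = A(t_1) - A(t_0)`), each
substep evaluated by the closed form of Theorem 4.1 with the split projector `P_i^±` of the
recursive SVD (mixed train) of its starting value (that these ARE its starting values is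
`sweepStart_eq` / `sweepK_eq_τ_mix`).  [cite: LubichOseledetsVandereycken2014, §4.1 Thm 4.1, §5 Thm 5.1] -/
def sweepStart (u a : CoreSpace σ L R) : (n : ℕ) → n < L → ((Fin L → σ) → ℝ)
  | 0, _ => τ a
  | n + 1, hn =>
      sweepStart u a n (Nat.lt_of_succ_lt hn) +
          plusProj (mix u a ⟨n, Nat.lt_of_succ_lt hn⟩ (bondPlus u a n)) ⟨n, Nat.lt_of_succ_lt hn⟩
            (τ u - τ a) -
        minusProj (mix u a ⟨n + 1, hn⟩ (bondMinus u a ⟨n, Nat.lt_of_succ_lt hn⟩))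
          ⟨n, Nat.lt_of_succ_lt hn⟩ (τ u - τ a)

/-- THE VALUE `Y_{n+1}^+(t_1) = Y_{n+1}^+(t_0) + P_{n+1}^+ ΔA` after the `K`-substep at the site `n`.
[cite: LubichOseledetsVandereycken2014, §4.1 Thm 4.1, §5 Thm 5.1] -/
def sweepK (u a : CoreSpace σ L R) (n : ℕ) (hn : n < L) : (Fin L → σ) → ℝ :=
  sweepStart u a n hn + plusProj (mix u a ⟨n, hn⟩ (bondPlus u a n)) ⟨n, hn⟩ (τ u - τ a)

omit [DecidableEq σ] in
/-- The recursion of the sweep: `Y_{i+1}^+(t_0) = Y_i^-(t_1) = Y_i^+(t_1) - P_i^- ΔA`.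
[cite: LubichOseledetsVandereycken2014, §4.1 Thm 4.1, §5 Thm 5.1] -/
theorem sweepStart_succ (u a : CoreSpace σ L R) (n : ℕ) (hn : n + 1 < L) :
    sweepStart u a (n + 1) hn =
      sweepK u a n (Nat.lt_of_succ_lt hn) -
        minusProj (mix u a ⟨n + 1, hn⟩ (bondMinus u a ⟨n, Nat.lt_of_succ_lt hn⟩))
          ⟨n, Nat.lt_of_succ_lt hn⟩ (τ u - τ a) := rfl

/-- THEOREM 5.1 / LEMMA 5.2 ALONG THE SWEEP: `Y_i^+(t_0) = P_{≤ i-1}^{(1)} A(t_0)`, as the mixed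
train `τ(U_1, …, U_{i-1}, S_{i-1}^+ • C_i, …, C_d)` whose split projector the `K`-substep uses.
Hypotheses: `A(t_1) = τ u`, `u` left-orthogonal; `A(t_0) = τ a` with right interfaces of full rank;
"`t_1 - t_0` sufficiently small": `Q_{≥ i+1}(t_1)ᵀ Q_{≥ i+1}(t_0)` invertible at every interior
bond.  [cite: LubichOseledetsVandereycken2014, §5 Thm 5.1, Lemma 5.2] -/
theorem sweepStart_eq {u a : CoreSpace σ L R} (hu : IsLeftOrth u) (h0 : R 0 = 1)
    (ha : ∀ ℓ : Fin L, IsUnit (rightQ a ℓ * (rightQ a ℓ)ᵀ).det)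
    (hS : ∀ ℓ : Fin L, (ℓ : ℕ) + 1 < L → IsUnit (rightQ u ℓ * (rightQ a ℓ)ᵀ).det) :
    ∀ (n : ℕ) (hn : n < L), sweepStart u a n hn = τ (mix u a ⟨n, hn⟩ (bondPlus u a n))
  | 0, hn => (τ_mix_zero u a h0 hn).symm
  | n + 1, hn => by
      have hn' : n < L := Nat.lt_of_succ_lt hn
      rw [sweepStart_succ, sweepK, sweepStart_eq hu h0 ha hS n hn',
        τ_mix_add_plusProj_of_lt hu h0 a ⟨n, hn'⟩ hn (ha _)]
      exact τ_mix_sub_minusProj_eq_τ_mix hu h0 a ⟨n, hn'⟩ hn (ha _) (hS _ hn)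

/-- LEMMA 5.2 ALONG THE SWEEP: `Y_i^+(t_1) = P_{≥ i+1}^{(0)} A(t_1)`.
[cite: LubichOseledetsVandereycken2014, §5 Lemma 5.2] -/
theorem sweepK_eq {u a : CoreSpace σ L R} (hu : IsLeftOrth u) (h0 : R 0 = 1)
    (ha : ∀ ℓ : Fin L, IsUnit (rightQ a ℓ * (rightQ a ℓ)ᵀ).det)
    (hS : ∀ ℓ : Fin L, (ℓ : ℕ) + 1 < L → IsUnit (rightQ u ℓ * (rightQ a ℓ)ᵀ).det)
    (n : ℕ) (hn : n < L) :
    sweepK u a n hn = rightProj a (n + 1) (L - (n + 1)) (succ_add_sub_succ ⟨n, hn⟩) (τ u) := by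
  rw [sweepK, sweepStart_eq hu h0 ha hS n hn]
  exact τ_mix_add_plusProj hu h0 a ⟨n, hn⟩ (ha _)

/-- LEMMA 5.2 ALONG THE SWEEP (`i < d`): `Y_i^+(t_1) = Y_i^-(t_0)` is the mixed train
`τ(U_1, …, U_i, S_i^- • C_{i+1}, …)` whose split projector `P_i^-` the `S`-substep uses.
[cite: LubichOseledetsVandereycken2014, §5 Lemma 5.2] -/
theorem sweepK_eq_τ_mix {u a : CoreSpace σ L R} (hu : IsLeftOrth u) (h0 : R 0 = 1)
    (ha : ∀ ℓ : Fin L, IsUnit (rightQ a ℓ * (rightQ a ℓ)ᵀ).det)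
    (hS : ∀ ℓ : Fin L, (ℓ : ℕ) + 1 < L → IsUnit (rightQ u ℓ * (rightQ a ℓ)ᵀ).det)
    (n : ℕ) (hn : n + 1 < L) :
    sweepK u a n (Nat.lt_of_succ_lt hn) =
      τ (mix u a ⟨n + 1, hn⟩ (bondMinus u a ⟨n, Nat.lt_of_succ_lt hn⟩)) := by
  rw [sweepK, sweepStart_eq hu h0 ha hS n (Nat.lt_of_succ_lt hn)]
  exact τ_mix_add_plusProj_of_lt hu h0 a ⟨n, Nat.lt_of_succ_lt hn⟩ hn (ha _)

/-- THEOREM 5.1 (EXACTNESS OF THE FIRST-ORDER SPLITTING INTEGRATOR): "Suppose `A(t) ∈ M` for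
`t ∈ [t_0, t_1]`.  Then, for sufficiently small `t_1 - t_0 > 0` the splitting integrator … is exact
when started from `Y_0 = A(t_0)`": `Y_d^+(t_1) = A(t_1)`.  Here `A(t_0) = τ a` (right interfaces
of full rank), `A(t_1) = τ u` (`u` left-orthogonal), `r_0 = r_d = 1`, and "sufficiently small"
is the invertibility of `Q_{≥ i+1}(t_1)ᵀ Q_{≥ i+1}(t_0)` at the interior bonds.
[cite: LubichOseledetsVandereycken2014, §5 Thm 5.1] -/
theorem sweepK_last_eq {u a : CoreSpace σ L R} (hu : IsLeftOrth u) (h0 : R 0 = 1) (hL : R L = 1)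
    (ha : ∀ ℓ : Fin L, IsUnit (rightQ a ℓ * (rightQ a ℓ)ᵀ).det)
    (hS : ∀ ℓ : Fin L, (ℓ : ℕ) + 1 < L → IsUnit (rightQ u ℓ * (rightQ a ℓ)ᵀ).det)
    (n : ℕ) (hn : n + 1 = L) :
    sweepK u a n (by omega) = τ u := by
  rw [sweepK, sweepStart_eq hu h0 ha hS n (by omega)]
  exact τ_mix_add_plusProj_last hu h0 hL a ⟨n, by omega⟩ hn (ha _)

/-- THEOREM 5.1 ON `W*_r` (points of the manifold `M_r = τ(W*_r)`): for `A(t_0) = τ a`,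
`A(t_1) = τ u` with `a, u ∈ W*_r`, `u` left-orthogonal, and `Q_{≥ i+1}(t_1)ᵀ Q_{≥ i+1}(t_0)`
invertible at the interior bonds, the forward sweep started at `A(t_0)` ends at `A(t_1)`.
[cite: LubichOseledetsVandereycken2014, §5 Thm 5.1] -/
theorem sweepK_last_eq_of_mem_fullRank {rk : ℕ → ℕ} {u a : CoreSpace σ L (bondDim L rk)}
    (hu : IsLeftOrth u) (ha : a ∈ fullRank σ L (bondDim L rk))
    (hS : ∀ ℓ : Fin L, (ℓ : ℕ) + 1 < L → IsUnit (rightQ u ℓ * (rightQ a ℓ)ᵀ).det)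
    (n : ℕ) (hn : n + 1 = L) :
    sweepK u a n (by omega) = τ u :=
  sweepK_last_eq hu bondDim_zero bondDim_self
    (fun _ => isUnit_det_rightInterfaceFn_of_mem_fullRank ha _ _ _) hS n hn

end CoreSpace

end Literature.LinearAlgebra.TensorNetworks
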